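import Literature.MathematicalPhysics.QuantumLattice.GroundStateSourceBounds
import Literature.MathematicalPhysics.QuantumLattice.HubbardLSMFillingProofs
import Literature.MathematicalPhysics.QuantumLattice.LiebRobinsonFnwGapProjectionsProofs
import Literature.Barriers.HubbardSuperconductivity.SourcedResponseEpsilonLift
import Literature.MathematicalPhysics.QuantumLattice.GroundStateDensityMatrixSupport
import Literature.MathematicalPhysics.QuantumLattice.SpinChainsAkltCorrelationProofs
import HarnessLib

/-!
# Sub-gap response is bounded by the ground-state fluctuation — the finite-volume Koma–Tasaki CONVERSE
# «response at one sub-gap field ⇒ FLOOR on the symmetric-point fluctuation», and the `d`-wave torus instance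

Cell `hubbard-cq` (D-0082 (c) / D-0085); dictionary row of `hubbard-cq-lens-transplant-1` g2 (DICTIONARY v2 §9,
`TransplantSketch2.lean`, lemma offer 2026-08-26T21:35Z), landed by seat `hubbard-cq-p1`. HONEST FRAMING: a
DICTIONARY THEOREM between finite-volume objects (door E1c: the modulus that buys the floor direction is the
SPECTRAL GAP `g` of the source-free matrix, a total-energy quantity; in a `U(1)`-broken phase `g(L) → 0` as the
tower spacing and the window `2h‖O‖ < g` closes) — no thermodynamic-limit content, not an instrument, not a card,
not an order-parameter statement, no phase word.

MODEL-FREE (§1–§3): `H` Hermitian with a UNIQUE GAPPED ground state (`Matrix.HasSpectralGap g`), unit ground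
vector `ψ₀`, `O` Hermitian at its SYMMETRIC POINT `⟨ψ₀, Oψ₀⟩ = 0`, `q := ‖Oψ₀‖² = ⟨ψ₀, O²ψ₀⟩`, `‖O‖` the
`ℓ²`-operator norm:
* (A1) `E₀(H − hO) ≥ E₀(H) − h²q/(g − h‖O‖)` (`0 ≤ h`, `h‖O‖ < g`) — two-level variational bound: for unit
  `ψ = αψ₀ + φ`, `φ ⊥ ψ₀`, `⟨ψ,(H − hO)ψ⟩ − E₀ ≥ (g − h‖O‖)‖φ‖² − 2h‖Oψ₀‖‖φ‖ ≥ −h²q/(g − h‖O‖)`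
  (`re_rayleigh_sub_smul_ge_of_hasSpectralGap`, `groundEnergy_sub_smul_ge_of_hasSpectralGap`);
* (A2) `Re ω_h(O) ≤ 4hq/(g − 2h‖O‖)` (`0 < h`, `2h‖O‖ < g`), `ω_h` the tracial ground-state functional of
  `H − hO`: concavity gives `h·Re ω_h(O) ≤ E₀(H − hO) − E₀(H − 2hO) ≤ E₀(H) − E₀(H − 2hO)`, then (A1) at `2h`
  (`re_groundStateFunctional_sub_smul_le_of_hasSpectralGap`); contrapositively, a response `Re ω_h(O) ≥ m` at ONE
  sub-gap field forces `q ≥ m(g − 2h‖O‖)/(4h)` — the one FLOOR-direction row of the transplant dictionary, the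
  non-perturbative finite-`h` form of the `T = 0` Duhamel-trivial direction `χ ≤ 2q/g`;
* (A3) window form: a density matrix `ρ` with `Re tr ρ(H − hO) ≤ E₀(H − hO) + δ` has
  `Re tr(ρO) ≤ δ/h + 4hq/(g − 2h‖O‖)` (`re_trace_mul_le_of_isDensityMatrix_of_hasSpectralGap`);
* §3: the same with hypotheses `ω₀(O) = 0`, `q = Re ω₀(O²)` on the tracial ground-state functional of `H`
  (= the vector state of `ψ₀`, `Matrix.groundStateFunctional_eq_of_hasUniqueGroundState`) — verbatim the
  sketch's `sourcedGroundEnergy_ge_of_gap` / `subGapResponse_le_fluctuation[_window]`.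

§4 (TREE UNITS) lives in the sequel `DWaveSourceSubGapResponse.lean`: the pair-sourced `t–t'` Hubbard torus
`A_L(h) = dWaveSourceTorusTT' L t' U μ h = A_L(0) − h·(Δ_d + Δ_dᴴ)`, `Re ω_h(O) = 2L²·m_L(h)`, under the HYPOTHESIS
`A_L(0).HasSpectralGap g` (no certified producer at 16 sites, census (11′)).

No definition, no named fact, no `sorry`; folklore linear algebra (second variational principle
`Matrix.HasSpectralGap.le_rayleigh_of_orthogonal`, chords of `GroundStateSourceBounds`).
References: T. Koma, H. Tasaki, J. Stat. Phys. 76 (1994) 745, §1 [KomaTasaki1994]; H. Tasaki, Physics and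
Mathematics of Quantum Many-Body Systems (2020) §2.1 [Tasaki2020]; L. Pitaevskii, S. Stringari, J. Low Temp. Phys.
85 (1991) 377, §2 (`m₋₁ ≤ m₀/ω_min`); F. J. Dyson, E. H. Lieb, B. Simon, J. Stat. Phys. 18 (1978) 335, §3
[DysonLiebSimon1978].
-/

noncomputable section

namespace Literature.MathematicalPhysics.QuantumLattice

open Matrix Literature.Barriers.HubbardSuperconductivity
open scoped Matrix.Norms.L2Operator ComplexOrder InnerProductSpace

/-! ### §1 The two-level variational bound (vector form) -/

section ModelFree

variable {n : Type*} [Fintype n] [DecidableEq n]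

omit [DecidableEq n] in
/-- Cauchy–Schwarz for the dot-product pairing `u† v` on `ℓ²(n)`. [folklore] -/
private theorem norm_star_dotProduct_le_norm_mul_norm (u v : n → ℂ) :
    ‖star u ⬝ᵥ v‖ ≤ ‖(WithLp.toLp 2 u : EuclideanSpace ℂ n)‖ * ‖(WithLp.toLp 2 v : EuclideanSpace ℂ n)‖ := by
  have e : star u ⬝ᵥ v = ⟪(WithLp.toLp 2 u : EuclideanSpace ℂ n), WithLp.toLp 2 v⟫_ℂ := by
    rw [EuclideanSpace.inner_toLp_toLp, dotProduct_comm]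
  rw [e]
  exact norm_inner_le_norm _ _

/-- **Two-level variational bound (vector form).** `H` with a unique gapped ground state (`HasSpectralGap g`),
unit ground vector `ψ₀`, `O` Hermitian with `⟨ψ₀, Oψ₀⟩ = 0`, `0 ≤ h`, `h‖O‖ < g`: for every unit `ψ`,
`⟨ψ, (H − hO)ψ⟩ ≥ E₀(H) − h²‖Oψ₀‖²/(g − h‖O‖)`. Proof: `ψ = αψ₀ + φ`, `φ ⊥ ψ₀`;
`⟨ψ,Hψ⟩ = |α|²E₀ + ⟨φ,Hφ⟩ ≥ E₀ + g‖φ‖²` (second variational principle), `Re⟨ψ,Oψ⟩ ≤ 2‖Oψ₀‖‖φ‖ + ‖O‖‖φ‖²`,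
and `(g − h‖O‖)s² − 2h‖Oψ₀‖s ≥ −h²‖Oψ₀‖²/(g − h‖O‖)`. [cite: Tasaki2020, §2.1] -/
theorem re_rayleigh_sub_smul_ge_of_hasSpectralGap {H O : Matrix n n ℂ} {g : ℝ} (hH : H.HasSpectralGap g)
    (hO : O.IsHermitian) {ψ₀ : n → ℂ} (hψ₀ : H.IsGroundStateVector ψ₀) (hψ₀1 : star ψ₀ ⬝ᵥ ψ₀ = 1)
    (hsym : star ψ₀ ⬝ᵥ O *ᵥ ψ₀ = 0) {h : ℝ} (hh : 0 ≤ h) (hg : h * ‖O‖ < g) {ψ : n → ℂ}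
    (hψ : star ψ ⬝ᵥ ψ = 1) :
    H.groundEnergy - h ^ 2 * (star (O *ᵥ ψ₀) ⬝ᵥ (O *ᵥ ψ₀)).re / (g - h * ‖O‖) ≤
      (star ψ ⬝ᵥ (H - (h : ℂ) • O) *ᵥ ψ).re := by
  have hHh : H.IsHermitian := hH.isHermitian
  have hE : H *ᵥ ψ₀ = (H.groundEnergy : ℂ) • ψ₀ := hψ₀.2
  set E₀ : ℝ := H.groundEnergy with hE₀
  set α : ℂ := star ψ₀ ⬝ᵥ ψ with hα
  set φ : n → ℂ := ψ - α • ψ₀ with hφ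
  have hdec : ψ = α • ψ₀ + φ := by rw [hφ]; abel
  have horth : star ψ₀ ⬝ᵥ φ = 0 := by
    rw [hφ, dotProduct_sub, dotProduct_smul, hψ₀1, smul_eq_mul, mul_one, hα, sub_self]
  have horth' : star φ ⬝ᵥ ψ₀ = 0 := by
    rw [star_dotProduct, horth, star_zero]
  -- cross terms with `H` vanish
  have hψ₀E : star ψ₀ ⬝ᵥ H *ᵥ ψ₀ = (E₀ : ℂ) := by
    rw [hE, dotProduct_smul, hψ₀1, smul_eq_mul, mul_one]
  have hHφ : star ψ₀ ⬝ᵥ H *ᵥ φ = 0 := by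
    rw [star_dotProduct_mulVec_of_isHermitian hHh, hE, star_smul, smul_dotProduct, horth, smul_zero]
  have hHφ' : star φ ⬝ᵥ H *ᵥ ψ₀ = 0 := by
    rw [hE, dotProduct_smul, horth', smul_zero]
  -- the `O` cross term
  set z : ℂ := star (O *ᵥ ψ₀) ⬝ᵥ φ with hz
  have hOz : star ψ₀ ⬝ᵥ O *ᵥ φ = z := by
    rw [star_dotProduct_mulVec_of_isHermitian hO]
  have hOz' : star φ ⬝ᵥ O *ᵥ ψ₀ = star z := by
    rw [hz, ← star_dotProduct]
  -- expansions of the three quadratic forms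
  have hnorm : star α * α + star φ ⬝ᵥ φ = 1 := by
    have e : star ψ ⬝ᵥ ψ = star α * α + star φ ⬝ᵥ φ := by
      rw [hdec]
      simp only [star_add, star_smul, add_dotProduct, dotProduct_add, smul_dotProduct, dotProduct_smul,
        smul_eq_mul, hψ₀1, horth, horth', mul_one, mul_zero, add_zero]
      ring
    rw [← e, hψ]
  have hHexp : star ψ ⬝ᵥ H *ᵥ ψ = star α * α * (E₀ : ℂ) + star φ ⬝ᵥ H *ᵥ φ := by
    rw [hdec]
    simp only [mulVec_add, mulVec_smul, star_add, star_smul, add_dotProduct, dotProduct_add, smul_dotProduct,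
      dotProduct_smul, smul_eq_mul, hψ₀E, hHφ, hHφ', mul_zero, add_zero, zero_add]
    ring
  have hOexp : star ψ ⬝ᵥ O *ᵥ ψ = star α * z + α * star z + star φ ⬝ᵥ O *ᵥ φ := by
    rw [hdec]
    simp only [mulVec_add, mulVec_smul, star_add, star_smul, add_dotProduct, dotProduct_add, smul_dotProduct,
      dotProduct_smul, smul_eq_mul, hsym, hOz, hOz', mul_zero, zero_add]
    ring
  -- real bookkeeping
  set r : ℝ := ‖(WithLp.toLp 2 (O *ᵥ ψ₀) : EuclideanSpace ℂ n)‖ with hr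
  set s : ℝ := ‖(WithLp.toLp 2 φ : EuclideanSpace ℂ n)‖ with hs
  have hr2 : (star (O *ᵥ ψ₀) ⬝ᵥ (O *ᵥ ψ₀)).re = r ^ 2 := star_dotProduct_self_re _
  have hs2 : (star φ ⬝ᵥ φ).re = s ^ 2 := star_dotProduct_self_re _
  have hz_le : ‖z‖ ≤ r * s := norm_star_dotProduct_le_norm_mul_norm _ _
  have haa : star α * α = ((‖α‖ ^ 2 : ℝ) : ℂ) := by
    rw [Complex.star_def, Complex.conj_mul', Complex.ofReal_pow]
  have ha1 : ‖α‖ ^ 2 + s ^ 2 = 1 := by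
    have e := congrArg Complex.re hnorm
    rw [Complex.add_re, haa, Complex.ofReal_re, hs2, Complex.one_re] at e
    exact e
  have hα1 : ‖α‖ ≤ 1 := by
    have h1 : ‖α‖ ^ 2 ≤ 1 := by nlinarith [sq_nonneg s]
    nlinarith [norm_nonneg α]
  -- the energy part
  have hHre : ‖α‖ ^ 2 * E₀ + (E₀ + g) * s ^ 2 ≤ (star ψ ⬝ᵥ H *ᵥ ψ).re := by
    have hgap := hH.le_rayleigh_of_orthogonal hψ₀ horth
    rw [hs2] at hgap
    rw [hHexp, Complex.add_re, haa, ← Complex.ofReal_mul, Complex.ofReal_re]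
    linarith
  -- the source part
  have hcross : (star α * z + α * star z).re ≤ 2 * (r * s) := by
    have e : (α * star z).re = (star α * z).re := by
      have e' : α * star z = star (star α * z) := by rw [star_mul, star_star, mul_comm]
      rw [e']
      exact Complex.conj_re _
    rw [Complex.add_re, e, ← two_mul]
    have h1 : (star α * z).re ≤ ‖star α * z‖ := Complex.re_le_norm _
    have h2 : ‖star α * z‖ = ‖α‖ * ‖z‖ := by rw [norm_mul, norm_star]
    have h3 : ‖α‖ * ‖z‖ ≤ ‖z‖ := by
      have := mul_le_mul_of_nonneg_right hα1 (norm_nonneg z)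
      rwa [one_mul] at this
    linarith
  have hOre : (star ψ ⬝ᵥ O *ᵥ ψ).re ≤ 2 * (r * s) + ‖O‖ * s ^ 2 := by
    rw [hOexp, Complex.add_re]
    have hφO := (abs_le.1 (abs_re_star_dotProduct_mulVec_le O φ)).2
    rw [hs2] at hφO
    linarith
  -- the Rayleigh quotient of `H − hO`
  have hsplit : (star ψ ⬝ᵥ (H - (h : ℂ) • O) *ᵥ ψ).re =
      (star ψ ⬝ᵥ H *ᵥ ψ).re - h * (star ψ ⬝ᵥ O *ᵥ ψ).re := by
    rw [sub_mulVec, smul_mulVec, dotProduct_sub, dotProduct_smul, Complex.sub_re, smul_eq_mul,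
      Complex.re_ofReal_mul]
  have hc : 0 < g - h * ‖O‖ := sub_pos.2 hg
  have hmul : h * (star ψ ⬝ᵥ O *ᵥ ψ).re ≤ h * (2 * (r * s) + ‖O‖ * s ^ 2) :=
    mul_le_mul_of_nonneg_left hOre hh
  have hE1 : ‖α‖ ^ 2 * E₀ + s ^ 2 * E₀ = E₀ := by
    calc ‖α‖ ^ 2 * E₀ + s ^ 2 * E₀ = (‖α‖ ^ 2 + s ^ 2) * E₀ := by ring
      _ = E₀ := by rw [ha1, one_mul]
  have hsq : 0 ≤ ((g - h * ‖O‖) * s - h * r) ^ 2 / (g - h * ‖O‖) := by positivity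
  have hsq' : ((g - h * ‖O‖) * s - h * r) ^ 2 / (g - h * ‖O‖) =
      (g - h * ‖O‖) * s ^ 2 - 2 * h * (r * s) + h ^ 2 * r ^ 2 / (g - h * ‖O‖) := by
    field_simp
    ring
  rw [hsplit, hr2]
  linarith [hHre, hmul, hE1, hsq, hsq']

/-! ### §2 (A1)–(A3): sourced ground energy, sourced response, and the window form -/

/-- With `⟨ψ₀, Oψ₀⟩ = 0` at a unit ground vector, the source never raises the ground energy:
`E₀(H − hO) ≤ E₀(H)` for every real `h` (trial state `ψ₀`). [cite: KomaTasaki1994, §1] -/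
theorem groundEnergy_sub_smul_le_of_sym {H O : Matrix n n ℂ} (hH : H.IsHermitian) (hO : O.IsHermitian)
    {ψ₀ : n → ℂ} (hψ₀ : H.IsGroundStateVector ψ₀) (hψ₀1 : star ψ₀ ⬝ᵥ ψ₀ = 1)
    (hsym : star ψ₀ ⬝ᵥ O *ᵥ ψ₀ = 0) (h : ℝ) :
    (H - (h : ℂ) • O).groundEnergy ≤ H.groundEnergy := by
  have hA : (H - (h : ℂ) • O).IsHermitian := isHermitian_sub_real_smul hH hO h
  have hray := groundEnergy_le_rayleigh_holds hA ψ₀ hψ₀1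
  rw [sub_mulVec, smul_mulVec, dotProduct_sub, dotProduct_smul, hsym, smul_zero, sub_zero, hψ₀.2,
    dotProduct_smul, hψ₀1, smul_eq_mul, mul_one, Complex.ofReal_re] at hray
  exact hray

/-- **(A1) Sourced ground energy below the gap.** `E₀(H − hO) ≥ E₀(H) − h²‖Oψ₀‖²/(g − h‖O‖)` for
`0 ≤ h`, `h‖O‖ < g` (unique gapped ground state `ψ₀`, `⟨ψ₀, Oψ₀⟩ = 0`). Together with
`groundEnergy_sub_smul_le_of_sym` this brackets the SOURCED energy by UNSOURCED data `(E₀, g, q)`.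
[cite: Tasaki2020, §2.1] -/
theorem groundEnergy_sub_smul_ge_of_hasSpectralGap [Nonempty n] {H O : Matrix n n ℂ} {g : ℝ}
    (hH : H.HasSpectralGap g) (hO : O.IsHermitian) {ψ₀ : n → ℂ} (hψ₀ : H.IsGroundStateVector ψ₀)
    (hψ₀1 : star ψ₀ ⬝ᵥ ψ₀ = 1) (hsym : star ψ₀ ⬝ᵥ O *ᵥ ψ₀ = 0) {h : ℝ} (hh : 0 ≤ h) (hg : h * ‖O‖ < g) :
    H.groundEnergy - h ^ 2 * (star (O *ᵥ ψ₀) ⬝ᵥ (O *ᵥ ψ₀)).re / (g - h * ‖O‖) ≤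
      (H - (h : ℂ) • O).groundEnergy := by
  have hA : (H - (h : ℂ) • O).IsHermitian := isHermitian_sub_real_smul hH.isHermitian hO h
  obtain ⟨ψ, hψmem, hψ1⟩ := EpsilonLift.exists_unit_mem_groundSpace hA
  rw [← (rayleigh_eq_groundEnergy_iff_holds hA ψ hψ1).2 hψmem]
  exact re_rayleigh_sub_smul_ge_of_hasSpectralGap hH hO hψ₀ hψ₀1 hsym hh hg hψ1

/-- **(A2) Sub-gap response ≤ fluctuation.** For `0 < h`, `2h‖O‖ < g`:
`Re ω_h(O) ≤ 4h‖Oψ₀‖²/(g − 2h‖O‖)`, `ω_h` the tracial ground-state functional of `H − hO`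
(`h·Re ω_h(O) ≤ E₀(H − hO) − E₀(H − 2hO) ≤ E₀(H) − E₀(H − 2hO)`, then (A1) at `2h`). Contrapositive
reading: a response `Re ω_h(O) ≥ m` at one sub-gap field forces `‖Oψ₀‖² ≥ m(g − 2h‖O‖)/(4h)`.
[cite: KomaTasaki1994, §1] -/
theorem re_groundStateFunctional_sub_smul_le_of_hasSpectralGap [Nonempty n] {H O : Matrix n n ℂ} {g : ℝ}
    (hH : H.HasSpectralGap g) (hO : O.IsHermitian) {ψ₀ : n → ℂ} (hψ₀ : H.IsGroundStateVector ψ₀)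
    (hψ₀1 : star ψ₀ ⬝ᵥ ψ₀ = 1) (hsym : star ψ₀ ⬝ᵥ O *ᵥ ψ₀ = 0) {h : ℝ} (hh : 0 < h)
    (hg : 2 * h * ‖O‖ < g) :
    ((H - (h : ℂ) • O).groundStateFunctional O).re ≤
      4 * h * (star (O *ᵥ ψ₀) ⬝ᵥ (O *ᵥ ψ₀)).re / (g - 2 * h * ‖O‖) := by
  have hHh := hH.isHermitian
  have hup := (re_groundStateFunctional_source_mem_Icc hHh hO hh (K := H) (O := O)).2
  have h0 := groundEnergy_sub_smul_le_of_sym hHh hO hψ₀ hψ₀1 hsym h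
  have h2 := groundEnergy_sub_smul_ge_of_hasSpectralGap hH hO hψ₀ hψ₀1 hsym (h := 2 * h) (by linarith) hg
  have hc : 0 < g - 2 * h * ‖O‖ := sub_pos.2 hg
  set q := (star (O *ᵥ ψ₀) ⬝ᵥ (O *ᵥ ψ₀)).re
  refine hup.trans ?_
  rw [div_le_iff₀ hh]
  have e : 4 * h * q / (g - 2 * h * ‖O‖) * h = (2 * h) ^ 2 * q / (g - 2 * h * ‖O‖) := by ring
  rw [e]
  linarith

/-- **(A3) Window form.** Any density matrix `ρ` with `Re tr ρ(H − hO) ≤ E₀(H − hO) + δ` (a certified sourced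
energy window) has `Re tr(ρO) ≤ δ/h + 4h‖Oψ₀‖²/(g − 2h‖O‖)` (`0 < h`, `2h‖O‖ < g`): subtract the variational
bound `Re tr ρ(H − 2hO) ≥ E₀(H − 2hO) ≥ E₀(H) − 4h²q/(g − 2h‖O‖)`. [cite: Tasaki2020, §2.1] -/
theorem re_trace_mul_le_of_isDensityMatrix_of_hasSpectralGap [Nonempty n] {H O ρ : Matrix n n ℂ} {g : ℝ}
    (hH : H.HasSpectralGap g) (hO : O.IsHermitian) {ψ₀ : n → ℂ} (hψ₀ : H.IsGroundStateVector ψ₀)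
    (hψ₀1 : star ψ₀ ⬝ᵥ ψ₀ = 1) (hsym : star ψ₀ ⬝ᵥ O *ᵥ ψ₀ = 0) {h : ℝ} (hh : 0 < h)
    (hg : 2 * h * ‖O‖ < g) (hρ : IsDensityMatrix ρ) {δ : ℝ}
    (hwin : (ρ * (H - (h : ℂ) • O)).trace.re ≤ (H - (h : ℂ) • O).groundEnergy + δ) :
    (ρ * O).trace.re ≤ δ / h + 4 * h * (star (O *ᵥ ψ₀) ⬝ᵥ (O *ᵥ ψ₀)).re / (g - 2 * h * ‖O‖) := by
  have hHh := hH.isHermitian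
  have h0 := groundEnergy_sub_smul_le_of_sym hHh hO hψ₀ hψ₀1 hsym h
  have h2 := groundEnergy_sub_smul_ge_of_hasSpectralGap hH hO hψ₀ hψ₀1 hsym (h := 2 * h) (by linarith) hg
  have hvar := groundEnergy_le_re_trace_mul_of_isDensityMatrix
    (isHermitian_sub_real_smul hHh hO (2 * h)) hρ
  have hc : 0 < g - 2 * h * ‖O‖ := sub_pos.2 hg
  set q := (star (O *ᵥ ψ₀) ⬝ᵥ (O *ᵥ ψ₀)).re
  -- `tr ρ(H − hO) − tr ρ(H − 2hO) = h · tr(ρO)`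
  have hdiff : (ρ * (H - (h : ℂ) • O)).trace.re - (ρ * (H - ((2 * h : ℝ) : ℂ) • O)).trace.re =
      h * (ρ * O).trace.re := by
    rw [← Complex.sub_re, ← trace_sub, ← Matrix.mul_sub]
    have e : H - (h : ℂ) • O - (H - ((2 * h : ℝ) : ℂ) • O) = (h : ℂ) • O := by
      rw [Complex.ofReal_mul, Complex.ofReal_ofNat]; module
    rw [e, Matrix.mul_smul, trace_smul, smul_eq_mul, Complex.re_ofReal_mul]
  have key : h * (ρ * O).trace.re ≤ δ + (2 * h) ^ 2 * q / (g - 2 * h * ‖O‖) := by linarith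
  rw [div_add_div _ _ hh.ne' hc.ne', le_div_iff₀ (mul_pos hh hc)]
  have e2 : (2 * h) ^ 2 * q / (g - 2 * h * ‖O‖) * (g - 2 * h * ‖O‖) = 4 * h * (h * q) := by
    field_simp
    ring
  nlinarith [key, hc, e2, mul_le_mul_of_nonneg_right key hc.le]

/-! ### §3 Tracial restatements (hypotheses on the ground-state functional `ω₀` of `H`) -/

/-- Under a unique ground state the tracial ground-state functional is the vector state of any unit ground
vector: `ω₀(X) = ⟨ψ₀, Xψ₀⟩`. [cite: Tasaki2020, §2.1] -/
theorem groundStateFunctional_eq_star_dotProduct_of_hasSpectralGap {H : Matrix n n ℂ} {g : ℝ}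
    (hH : H.HasSpectralGap g) {ψ₀ : n → ℂ} (hψ₀ : H.IsGroundStateVector ψ₀) (hψ₀1 : star ψ₀ ⬝ᵥ ψ₀ = 1)
    (X : Matrix n n ℂ) : H.groundStateFunctional X = star ψ₀ ⬝ᵥ X *ᵥ ψ₀ := by
  obtain ⟨hne, hmem⟩ := (isGroundStateVector_iff H ψ₀).1 hψ₀
  rw [groundStateFunctional_eq_of_hasUniqueGroundState hH.hasUniqueGroundState hmem hne X, hψ₀1, div_one]

omit [DecidableEq n] in
/-- The fluctuation in the two spellings: `⟨ψ₀, O²ψ₀⟩ = ‖Oψ₀‖²` for Hermitian `O`. [folklore] -/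
private theorem star_dotProduct_mul_mulVec_of_isHermitian {O : Matrix n n ℂ} (hO : O.IsHermitian) (ψ₀ : n → ℂ) :
    star ψ₀ ⬝ᵥ (O * O) *ᵥ ψ₀ = star (O *ᵥ ψ₀) ⬝ᵥ (O *ᵥ ψ₀) := by
  rw [← mulVec_mulVec, star_dotProduct_mulVec_of_isHermitian hO]

/-- **(A1), tracial hypotheses.** `H.HasSpectralGap g`, `O` Hermitian, `ω₀(O) = 0`, `0 ≤ h`, `h‖O‖ < g` ⇒
`E₀(H) − h²·Re ω₀(O²)/(g − h‖O‖) ≤ E₀(H − hO)` — verbatim `TransplantSketch2.sourcedGroundEnergy_ge_of_gap`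
(on a nonempty index type). [cite: Tasaki2020, §2.1] -/
theorem groundEnergy_sub_smul_ge_of_groundStateFunctional [Nonempty n] {H O : Matrix n n ℂ} {g : ℝ}
    (hH : H.HasSpectralGap g) (hO : O.IsHermitian) (hsym : H.groundStateFunctional O = 0) {h : ℝ}
    (hh : 0 ≤ h) (hg : h * ‖O‖ < g) :
    H.groundEnergy - h ^ 2 * (H.groundStateFunctional (O * O)).re / (g - h * ‖O‖) ≤
      (H - (h : ℂ) • O).groundEnergy := by
  obtain ⟨ψ₀, hmem, hψ₀1⟩ := EpsilonLift.exists_unit_mem_groundSpace hH.isHermitian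
  have hne : ψ₀ ≠ 0 := by
    intro h0; rw [h0, dotProduct_zero] at hψ₀1; exact zero_ne_one hψ₀1
  have hψ₀ : H.IsGroundStateVector ψ₀ := (isGroundStateVector_iff H ψ₀).2 ⟨hne, hmem⟩
  rw [groundStateFunctional_eq_star_dotProduct_of_hasSpectralGap hH hψ₀ hψ₀1] at hsym ⊢
  rw [star_dotProduct_mul_mulVec_of_isHermitian hO]
  exact groundEnergy_sub_smul_ge_of_hasSpectralGap hH hO hψ₀ hψ₀1 hsym hh hg

/-- **(A2), tracial hypotheses.** `Re ω_h(O) ≤ 4h·Re ω₀(O²)/(g − 2h‖O‖)` for `0 < h`, `2h‖O‖ < g` — verbatim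
`TransplantSketch2.subGapResponse_le_fluctuation`. [cite: KomaTasaki1994, §1] -/
theorem re_groundStateFunctional_sub_smul_le_of_groundStateFunctional [Nonempty n] {H O : Matrix n n ℂ}
    {g : ℝ} (hH : H.HasSpectralGap g) (hO : O.IsHermitian) (hsym : H.groundStateFunctional O = 0) {h : ℝ}
    (hh : 0 < h) (hg : 2 * h * ‖O‖ < g) :
    ((H - (h : ℂ) • O).groundStateFunctional O).re ≤
      4 * h * (H.groundStateFunctional (O * O)).re / (g - 2 * h * ‖O‖) := by
  obtain ⟨ψ₀, hmem, hψ₀1⟩ := EpsilonLift.exists_unit_mem_groundSpace hH.isHermitian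
  have hne : ψ₀ ≠ 0 := by
    intro h0; rw [h0, dotProduct_zero] at hψ₀1; exact zero_ne_one hψ₀1
  have hψ₀ : H.IsGroundStateVector ψ₀ := (isGroundStateVector_iff H ψ₀).2 ⟨hne, hmem⟩
  rw [groundStateFunctional_eq_star_dotProduct_of_hasSpectralGap hH hψ₀ hψ₀1] at hsym ⊢
  rw [star_dotProduct_mul_mulVec_of_isHermitian hO]
  exact re_groundStateFunctional_sub_smul_le_of_hasSpectralGap hH hO hψ₀ hψ₀1 hsym hh hg

/-- **(A3), tracial hypotheses** — verbatim `TransplantSketch2.subGapResponse_le_fluctuation_window` with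
`IsDensityMatrix ρ` (`ρ ⪰ 0`, `tr ρ = 1`). [cite: Tasaki2020, §2.1] -/
theorem re_trace_mul_le_of_isDensityMatrix_of_groundStateFunctional [Nonempty n] {H O ρ : Matrix n n ℂ}
    {g : ℝ} (hH : H.HasSpectralGap g) (hO : O.IsHermitian) (hsym : H.groundStateFunctional O = 0) {h : ℝ}
    (hh : 0 < h) (hg : 2 * h * ‖O‖ < g) (hρ : IsDensityMatrix ρ) {δ : ℝ}
    (hwin : (ρ * (H - (h : ℂ) • O)).trace.re ≤ (H - (h : ℂ) • O).groundEnergy + δ) :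
    (ρ * O).trace.re ≤ δ / h + 4 * h * (H.groundStateFunctional (O * O)).re / (g - 2 * h * ‖O‖) := by
  obtain ⟨ψ₀, hmem, hψ₀1⟩ := EpsilonLift.exists_unit_mem_groundSpace hH.isHermitian
  have hne : ψ₀ ≠ 0 := by
    intro h0; rw [h0, dotProduct_zero] at hψ₀1; exact zero_ne_one hψ₀1
  have hψ₀ : H.IsGroundStateVector ψ₀ := (isGroundStateVector_iff H ψ₀).2 ⟨hne, hmem⟩
  rw [groundStateFunctional_eq_star_dotProduct_of_hasSpectralGap hH hψ₀ hψ₀1] at hsym ⊢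
  rw [star_dotProduct_mul_mulVec_of_isHermitian hO]
  exact re_trace_mul_le_of_isDensityMatrix_of_hasSpectralGap hH hO hψ₀ hψ₀1 hsym hh hg hρ hwin

end ModelFree


end Literature.MathematicalPhysics.QuantumLattice

end
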